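import Summits.CriticalPhenomena.PercolationContinuityZ3.Theorems.Transplant.KNCells2ChainBandR
import Summits.CriticalPhenomena.PercolationContinuityZ3.Theorems.Transplant.KNCellsBoxProdZ2InnerRun
import Summits.CriticalPhenomena.PercolationContinuityZ3.Theorems.Transplant.PlanarCells2FaceRows
import HarnessLib

/-!
# The PLANAR INNER RUN of a face-step contact, two units and band widths (D″ v2 (F) = P4-GENERAL §16.4 (U4′); DPRIME-SCOPE §2 L6′ /
# p3 addendum M): a rooted band run (`ChainPlanar.Band` cores of p1-g9's `KNCells2ChainBand`, rooted regions `Band.regionR` of `KNCells2ChainBandR`)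
# placed at the landing row of the contact's kit centre, climbing through the shrunk far rows `P.farAS x du j` to a face inside `P.M (x + du)`:
# admissibility and the two planar facts (regions inside `farAS`, far face inside `M`), plus membership in the start row — two-unit twin
# of p2's `KNCellsBoxProdZ2InnerRun` (there: squares `Adv`, one unit `r`, far rows `farA`); rooted regions `Band.regionR` of p1-g9's `KNCells2ChainBandR`

builds on p205010 (kernel theorem, internal audit signed; external expert review pending) — nothing in this file uses p205010.
Lane `prim-bschramm`, seat `prim-hp-8` (gen 30; L6′ (F) owner, claim 2026-08-21T05:04Z); helper file (`--supports stmt-CriticalPhenomena-4575`).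
Pure `Site 2` geometry.  Parameters (signed levels relative to `P.cen x` along `du`; run-axis unit `r∥ = P.r du.1`, transverse unit
`r⊥ = P.r (oth du.1)`): centre `innerCtr2 P x du ca cb = P.cen x + rootCtr du ca cb` (start box centred at level `ca`, transverse offset
`cb`), start core = the box of half-length `q` along the axis and half-width `q'` across (the D″ v2 inner route starts KIT-NARROW at the contact's
kit centre: `q = q' =` the zone scale, p3-g7 2026-08-21T05:09:29Z R3; `q = 0` is tonight's landing-row start), line spacing `s₁` (`= e∥` at the
consumer; lines at levels `ca + q + k s₁`, `k = 1 … nA+1`), maximal band half-width `WM` with `Wb ℓ ≤ WM` on `ℓ ≤ 2q + s₁ + R'`, region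
half-width `innerρB q q' s₁ R' nA WM = q' + 3q + s₁ + (nA+3)R' + 2 WM` (what `Band.BandOK` needs), region `0` reaching `ρ₀ = 3q + s₁ + 2R'`
below the centre (`Band.regionR`).
`InnerRunOK2 P du j s₁ R' ℓ₀ nA ca cb q q' WM Wb`: `0 ≤ q`, `0 ≤ q'`, `R' + ℓ₀ ≤ s₁`, `2R' ≤ s₁`, `Wb ≤ WM` on `[0, 2q + s₁ + R']`,
`5r∥ + 10s∥ j + 2 + 3q + s₁ + 2R' ≤ ca` (region `0` above the stub of level `j`, inside the SHRUNK rows), `17r∥ ≤ ca + q + (nA+1)s₁ ≤ 23r∥` (far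
face at the levels of `M (x+du)`), `|cb| + innerρB ≤ 5r⊥ − 2`, `|cb| + q' + WM + (nA+1)R' ≤ 3r⊥`.
* `innerRun_bandOK`, **`innerRun_regionR_subset_farAS`**, **`innerRun_last_subset_M`**, `mem_innerCore_zero`.
[cite: KozmaNitzan2024, §4 Lemma 11 (pp. 22–23), p. 30 (Step III)]
-/

noncomputable section

namespace Summit.CriticalPhenomena.PercolationContinuityZ3.Theorems

namespace Transplant

namespace PCells2

open Literature.Probability.Percolation Literature.Probability.LatticeModels
open Literature.Probability.Percolation.KozmaNitzan
open Literature.Probability.Percolation.KozmaNitzan.Cells (oth oth_ne eq_oth_of_ne sgOf sgOf_sign stepVec_apply_fst stepVec_apply_oth)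
open ChainPlanar
open BoxProdZ2 (rootCtr rootCtr_fst rootCtr_oth sg_mul_sub_add)
open PCells (mem_psBox_iff)

/-- The centre of the inner run at the macro-vertex `x` (two units): `P.cen x` shifted to signed level `ca` and transverse offset `cb`. [folklore] -/
def innerCtr2 (P : PCells2) (x : Site 2) (du : MDir) (ca cb : ℤ) : Site 2 := P.cen x + rootCtr du ca cb

/-- The region half-width of the inner band run: `q' + 3q + s₁ + (nA+3) R' + 2 WM` (dominates both `3q + s₁ + 2R'` and
`q' + (nA+1)R' + 2WM`). [folklore] -/
def innerρB (q q' s₁ : ℤ) (R' nA WM : ℕ) : ℤ := q' + 3 * q + s₁ + ((nA : ℤ) + 3) * R' + 2 * WM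

/-- **Admissible parameters of the inner band run of a face-step contact, two units.** [this work] -/
structure InnerRunOK2 (P : PCells2) (du : MDir) (j : ℕ) (s₁ : ℤ) (R' ℓ₀ nA : ℕ) (ca cb q q' : ℤ) (WM : ℕ) (Wb : ℕ → ℕ) : Prop where
  /-- the start box has a nonnegative half-length -/
  hq : 0 ≤ q
  /-- the start box has a nonnegative half-width -/
  hq' : 0 ≤ q'
  /-- route scales fit in one advance -/
  hs : (R' : ℤ) + ℓ₀ ≤ s₁
  /-- the neighbourhood radius is small -/
  hs2 : 2 * (R' : ℤ) ≤ s₁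
  /-- the band half-widths used by the routes are bounded by `WM` -/
  hWM : ∀ ℓ : ℕ, (ℓ : ℤ) ≤ 2 * q + s₁ + R' → Wb ℓ ≤ WM
  /-- region `0` stays above the stub of level `j`, inside the shrunk far rows -/
  hlo : 5 * (P.r du.1 : ℤ) + 10 * P.s du.1 * j + 2 + 3 * q + s₁ + 2 * R' ≤ ca
  /-- the far face is at least at level `17 r∥` -/
  hfar1 : 17 * (P.r du.1 : ℤ) ≤ ca + q + ((nA : ℤ) + 1) * s₁
  /-- the far face is at most at level `23 r∥` -/
  hfar2 : ca + q + ((nA : ℤ) + 1) * s₁ ≤ 23 * (P.r du.1 : ℤ)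
  /-- the regions stay inside the shrunk far rows transversally -/
  htr : |cb| + innerρB q q' s₁ R' nA WM ≤ 5 * (P.r (oth du.1) : ℤ) - 2
  /-- the far face stays inside `M (x + du)` transversally -/
  htrM : |cb| + q' + WM + ((nA : ℤ) + 1) * R' ≤ 3 * (P.r (oth du.1) : ℤ)

variable {P : PCells2} {x : Site 2} {du : MDir} {j : ℕ} {s₁ : ℤ} {R' ℓ₀ nA : ℕ} {ca cb q q' : ℤ} {WM : ℕ} {Wb : ℕ → ℕ}
  (h : InnerRunOK2 P du j s₁ R' ℓ₀ nA ca cb q q' WM Wb)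
include h

omit h in
/-- The centre along the axis. [folklore] -/
@[simp] theorem innerCtr2_fst : innerCtr2 P x du ca cb du.1 = P.cen x du.1 + sgOf du * ca := by
  simp [innerCtr2, rootCtr]

omit h in
/-- The centre across the axis. [folklore] -/
@[simp] theorem innerCtr2_oth : innerCtr2 P x du ca cb (oth du.1) = P.cen x (oth du.1) + cb := by
  simp [innerCtr2, rootCtr, oth_ne]

/-- **The inner run is an admissible band run.** [cite: KozmaNitzan2024, §4 Lemma 11] -/
theorem innerRun_bandOK : Band.BandOK q q' s₁ (innerρB q q' s₁ R' nA WM) R' ℓ₀ nA WM Wb where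
  hq := h.hq
  hq' := h.hq'
  hs := h.hs
  hs2 := h.hs2
  hρ0 := by
    unfold innerρB; have := h.hq'
    have hR0 : (0 : ℤ) ≤ R' := by positivity
    have hW0 : (0 : ℤ) ≤ WM := by positivity
    have hNR : (0 : ℤ) ≤ (nA : ℤ) * R' := by positivity
    nlinarith
  hρ := by
    unfold innerρB; have := h.hq
    have hR0 : (0 : ℤ) ≤ R' := by positivity
    have hs0 : (0 : ℤ) ≤ s₁ := by linarith [h.hs2]
    nlinarith
  hWM := h.hWM

/-- **Every rooted region of the inner run lies in `farAS x du j`** (`k ≤ nA`). [cite: KozmaNitzan2024, §4 Lemma 11 (p. 22: Ω), p. 30] -/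
theorem innerRun_regionR_subset_farAS {k : ℕ} (hk : k ≤ nA) :
    Band.regionR q s₁ (innerρB q q' s₁ R' nA WM) R' du.1 (sgOf du) (innerCtr2 P x du ca cb) k ⊆ P.farAS x du j := by
  intro y hy
  have hy' := Band.regionR_subset_prism (sgOf_sign du) (innerCtr2 P x du ca cb) (innerRun_bandOK h) hk hy
  rw [mem_psBox_iff] at hy'
  simp only [innerCtr2_fst, innerCtr2_oth, sg_mul_sub_add, Adv.ρ₀] at hy'
  obtain ⟨⟨hl1, hl2⟩, hb1, hb2⟩ := hy'
  have hlo := h.hlo; have hfar2 := h.hfar2; have htr := h.htr; have hq' := h.hq'; have hq := h.hq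
  have hR0 : (0 : ℤ) ≤ R' := by positivity
  have hW0 : (0 : ℤ) ≤ WM := by positivity
  have hN0 : (0 : ℤ) ≤ nA := by positivity
  have hNR : (0 : ℤ) ≤ (nA : ℤ) * R' := by positivity
  unfold innerρB at hb1 hb2 htr
  have hcb := le_abs_self cb
  have hcb' := neg_abs_le cb
  have hr1 : (1 : ℤ) ≤ P.r du.1 := by exact_mod_cast P.one_le_r du.1
  rw [PCells2.farAS, mem_psBox_iff]
  refine ⟨⟨by linarith, by linarith⟩, by linarith, by linarith⟩

/-- **The far face of the inner run lies in `M (x + du)`** (two units). [cite: KozmaNitzan2024, §4 p. 26 (M_v), p. 30] -/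
theorem innerRun_last_subset_M :
    Band.core q q' s₁ R' WM du.1 (sgOf du) (innerCtr2 P x du ca cb) (nA + 1) ⊆ P.M (x + stepVec du) := by
  intro y hy
  rw [(Band.core_zero_last (q := q) (q' := q') (s₁ := s₁) (R' := R') (WM := WM) (N := nA) (a := du.1) (σ := sgOf du)
    (c := innerCtr2 P x du ca cb)).2, mem_psBox_iff] at hy
  simp only [innerCtr2_fst, innerCtr2_oth, sg_mul_sub_add] at hy
  obtain ⟨⟨hl1, hl2⟩, hb1, hb2⟩ := hy
  have hfar1 := h.hfar1; have hfar2 := h.hfar2; have htrM := h.htrM; have hq' := h.hq'; have hq := h.hq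
  have hR0 : (0 : ℤ) ≤ R' := by positivity
  unfold Band.w₁ at hb1 hb2
  have hcb := le_abs_self cb
  have hcb' := neg_abs_le cb
  rw [PCells2.M, P.mem_abox_iff]
  intro i
  push_cast
  by_cases hi : i = du.1
  · subst hi
    rw [P.cen_add_stepVec_fst]
    rcases sgOf_sign du with hs | hs
    · rw [hs] at hl1 hl2
      simp only [one_mul] at hl1 hl2
      rw [hs]; constructor <;> linarith
    · rw [hs] at hl1 hl2
      rw [hs]; constructor <;> linarith
  · rw [eq_oth_of_ne hi, P.cen_add_stepVec_oth]
    constructor <;> linarith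

omit h in
/-- **Membership in the start box** `core 0 = {|level − ca| ≤ q, |trans − (cen_⊥ + cb)| ≤ q'}` (it must contain the planar shadow of the wired
seed of the route). [folklore] -/
theorem mem_innerCore_zero {y : Site 2} :
    y ∈ Band.core q q' s₁ R' WM du.1 (sgOf du) (innerCtr2 P x du ca cb) 0 ↔
      (ca - q ≤ sgOf du * (y du.1 - P.cen x du.1) ∧ sgOf du * (y du.1 - P.cen x du.1) ≤ ca + q) ∧
        P.cen x (oth du.1) + cb - q' ≤ y (oth du.1) ∧ y (oth du.1) ≤ P.cen x (oth du.1) + cb + q' := by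
  rw [(Band.core_zero_last (q := q) (q' := q') (s₁ := s₁) (R' := R') (WM := WM) (N := 0) (a := du.1) (σ := sgOf du)
    (c := innerCtr2 P x du ca cb)).1, mem_psBox_iff]
  simp only [innerCtr2_fst, innerCtr2_oth, sg_mul_sub_add]
  constructor
  · rintro ⟨⟨h1, h2⟩, h3, h4⟩; exact ⟨⟨by linarith, by linarith⟩, h3, h4⟩
  · rintro ⟨⟨h1, h2⟩, h3, h4⟩; exact ⟨⟨by linarith, by linarith⟩, h3, h4⟩

end PCells2

end Transplant

end Summit.CriticalPhenomena.PercolationContinuityZ3.Theorems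

end
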